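import Summits.HubbardSuperconductivity.HubbardSuperconductivity.Theorems.BalabanIRBirGroundStateAverageLROSoftminTransferFree
import Literature.MathematicalPhysics.QuantumLattice.FinDimSpectrumSectorGibbsLimit

/-!
# Route BalabanIR — crux `BirGroundStateAverageLRO` (item `stmt-HubbardSuperconductivity-2079`), line `Sketch` (softmin-pair-penalty): ground states of the pair-penalised Hamiltonian

First of three files proving that the free-schedule engine socket of line `Sketch`
(`stub_freePenalisedFloor` / `transfer_free`, file `…SoftminTransferFree`) is EQUIVALENT, up to
constants, to every-ground-state pair order. This file: the finite-dimensional core, for a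
Hermitian `H`, a positive semidefinite `A` bounded by `M`, an `H`-invariant subspace `K` with
sector energy `e = minEnergyOn H K` and sector ground eigenspace `E₀ = K ⊓ ker(H - e)`:

* `re_quadForm_ge_of_orthogonal_groundSpace` — second-eigenvalue bound in the sector: a gap
  `γ` of the spectrum of `H` above `e` gives `(e + γ)‖φ‖² ≤ Re⟨φ, Hφ⟩` for `φ ∈ K ⊖ E₀`;
* `re_quadForm_ge_of_penalisedGroundState` (registered lead-held stub of line `Sketch`) — if
  every vector of `E₀` has `Re⟨ψ, Aψ⟩ ≥ m‖ψ‖²` and `2gM(m + 2M) ≤ γm`, then every unit `φ ∈ K`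
  with `Re⟨φ, (H + gA)φ⟩ ≤ e + gM` (every ground state of the penalised `H + gA` in `K`) has
  `Re⟨φ, Aφ⟩ ≥ m/4` (decompose `φ = P_{E₀}φ + φ₁`, `γ‖φ₁‖² ≤ gM`, PSD polarisation).

Companions: `…SoftminThermalFloorOfGroundStates` (pass to the thermal state at large `β`),
`…SoftminSocketEquiv` (the Hubbard torus). Sources: T. Kato, *Perturbation Theory for Linear
Operators* (1966) §II.5 (first-order splitting of a degenerate level — only its variational
sandwich is used); H. Tasaki (2020) App. A, §2.2. Folklore; no definition is introduced.
-/

noncomputable section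

namespace Summit.HubbardSuperconductivity.HubbardSuperconductivity.Theorems.BirGroundStateAverageLRO.Softmin

open Matrix Finset Filter Topology Literature.MathematicalPhysics.QuantumLattice Literature.Probability.LatticeModels
open Summit.HubbardSuperconductivity.HubbardSuperconductivity.Theses.BalabanIR
open Summit.HubbardSuperconductivity.HubbardSuperconductivity.Theorems
open scoped ComplexOrder

section Abstract

variable {n : Type*} [Fintype n] [DecidableEq n]

omit [DecidableEq n] in
/-- A finite family of reals has a positive gap above any level `e`: some `γ > 0` with
`e < λᵢ → e + γ ≤ λᵢ`. [folklore] -/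
theorem exists_gap_above (lam : n → ℝ) (e : ℝ) :
    ∃ γ : ℝ, 0 < γ ∧ ∀ i, e < lam i → e + γ ≤ lam i := by
  classical
  by_cases hT : (Finset.univ.filter fun i => e < lam i).Nonempty
  · refine ⟨(Finset.univ.filter fun i => e < lam i).inf' hT (fun i => lam i - e), ?_, ?_⟩
    · rw [Finset.lt_inf'_iff]
      intro i hi
      rw [Finset.mem_filter] at hi
      linarith [hi.2]
    · intro i hi
      have hmem : i ∈ Finset.univ.filter fun i => e < lam i := by simp [hi]
      have := Finset.inf'_le (fun i => lam i - e) hmem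
      linarith
  · refine ⟨1, one_pos, fun i hi => ?_⟩
    exact absurd ⟨i, by simp [hi]⟩ hT

/-- `v - P_K v ⊥ K`: `star w ⬝ᵥ (v - P_K v) = 0` for `w ∈ K`
(`Submodule.sub_starProjection_mem_orthogonal`, transported along `projMatrix_mulVec`). [folklore] -/
theorem star_dotProduct_sub_projMatrix_map_mulVec (K : Submodule ℂ (n → ℂ)) (v : n → ℂ)
    {w : n → ℂ} (hw : w ∈ K) :
    star w ⬝ᵥ (v - projMatrix (K.map ((WithLp.linearEquiv 2 ℂ (n → ℂ)).symm :
      (n → ℂ) →ₗ[ℂ] EuclideanSpace ℂ n)) *ᵥ v) = 0 := by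
  set K' := K.map ((WithLp.linearEquiv 2 ℂ (n → ℂ)).symm : (n → ℂ) →ₗ[ℂ] EuclideanSpace ℂ n)
    with hK'
  have h1 := projMatrix_mulVec K' (WithLp.toLp 2 v)
  rw [WithLp.ofLp_toLp] at h1
  have horth := Submodule.sub_starProjection_mem_orthogonal (K := K') (WithLp.toLp 2 v)
  rw [Submodule.mem_orthogonal] at horth
  have hwK' : (WithLp.toLp 2 w : EuclideanSpace ℂ n) ∈ K' := by
    rw [hK', mem_map_withLpLinearEquiv_symm_iff, WithLp.ofLp_toLp]; exact hw
  have h2 := horth _ hwK'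
  rw [EuclideanSpace.inner_eq_star_dotProduct, WithLp.ofLp_toLp, dotProduct_comm, WithLp.ofLp_sub,
    WithLp.ofLp_toLp] at h2
  rw [h1]
  exact h2

/-- **Second-eigenvalue bound in a sector.** `H` Hermitian, `K` an `H`-invariant subspace,
`e = minEnergyOn H K`, `E₀ = K ⊓ ker(H - e)`, and `γ > 0` a gap of the spectrum of `H` above `e`
(`e < λᵢ → e + γ ≤ λᵢ`). Then every `φ ∈ K` orthogonal to `E₀` has
`(e + γ)·Re⟨φ, φ⟩ ≤ Re⟨φ, H φ⟩` (expand in the eigenbasis: the coefficients on eigenvectors with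
`λᵢ ≤ e` vanish, because `P_K uᵢ` is `0` for `λᵢ < e` and lies in `E₀` for `λᵢ = e`). [folklore] -/
theorem re_quadForm_ge_of_orthogonal_groundSpace {H : Matrix n n ℂ} (hH : H.IsHermitian)
    (K : Submodule ℂ (n → ℂ)) (hKH : ∀ v ∈ K, H *ᵥ v ∈ K) {γ : ℝ}
    (hgap : ∀ i, H.minEnergyOn K < hH.eigenvalues i → H.minEnergyOn K + γ ≤ hH.eigenvalues i)
    {φ : n → ℂ} (hφK : φ ∈ K)
    (hφorth : ∀ w ∈ K ⊓ Module.End.eigenspace (Matrix.toLin' H) ((H.minEnergyOn K : ℝ) : ℂ),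
      star w ⬝ᵥ φ = 0) :
    (H.minEnergyOn K + γ) * (star φ ⬝ᵥ φ).re ≤ (star φ ⬝ᵥ (H *ᵥ φ)).re := by
  set e : ℝ := H.minEnergyOn K with he
  set P := projMatrix (K.map ((WithLp.linearEquiv 2 ℂ (n → ℂ)).symm :
    (n → ℂ) →ₗ[ℂ] EuclideanSpace ℂ n)) with hP
  set U : Matrix n n ℂ := (hH.eigenvectorUnitary : Matrix n n ℂ) with hU
  have hUu : U ∈ unitary (Matrix n n ℂ) := hH.eigenvectorUnitary.prop
  have hPh : P.IsHermitian := projMatrix_isHermitian _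
  have hPφ : P *ᵥ φ = φ := projMatrix_map_mulVec_of_mem K hφK
  -- columns of `U` are eigenvectors
  have hcol : ∀ j, H *ᵥ (fun i => U i j) = ((hH.eigenvalues j : ℝ) : ℂ) • (fun i => U i j) := by
    intro j
    have h : (fun i => U i j) = ⇑(hH.eigenvectorBasis j) :=
      funext fun i => IsHermitian.eigenvectorUnitary_apply hH i j
    rw [h, hH.mulVec_eigenvectorBasis j, RCLike.real_smul_eq_coe_smul (K := ℂ)]
    rfl
  -- the coefficient `cⱼ = ⟨uⱼ, φ⟩ = ⟨P uⱼ, φ⟩`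
  have hcoef : ∀ j, (star U *ᵥ φ) j = star (P *ᵥ fun i => U i j) ⬝ᵥ φ := by
    intro j
    have h1 : (star U *ᵥ φ) j = star (fun i => U i j) ⬝ᵥ φ := by
      simp only [mulVec, dotProduct, star_apply, Pi.star_apply]
    rw [h1]
    conv_lhs => rw [← hPφ]
    rw [dotProduct_mulVec, star_mulVec, hPh.eq]
  -- coefficients on `λⱼ ≤ e` vanish
  have hzero : ∀ j, hH.eigenvalues j ≤ e → (star U *ᵥ φ) j = 0 := by
    intro j hj
    rw [hcoef j]
    rcases lt_or_eq_of_le hj with hlt | heq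
    · rw [projMatrix_map_mulVec_eigenvector_below_eq_zero hH K hKH (hcol j) hlt, star_zero,
        zero_dotProduct]
    · apply hφorth
      refine Submodule.mem_inf.2 ⟨projMatrix_map_mulVec_mem K _, ?_⟩
      rw [Module.End.mem_eigenspace_iff, Matrix.toLin'_apply, mulVec_mulVec, hP,
        ← projMatrix_map_commute_of_invariant hH K hKH, ← mulVec_mulVec, hcol j, mulVec_smul, heq]
  -- spectral sums
  rw [re_quadForm_eq_sum_eigenvalues hH φ, ← sum_norm_sq_star_mulVec hUu φ, Finset.mul_sum]
  refine Finset.sum_le_sum fun j _ => ?_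
  by_cases hj : hH.eigenvalues j ≤ e
  · rw [hzero j hj]; simp
  · push Not at hj
    exact mul_le_mul_of_nonneg_right (hgap j hj) (by positivity)

omit [DecidableEq n] in
/-- Real part of the quadratic form of a sum of two vectors against a Hermitian matrix:
`Re⟨x + y, A(x + y)⟩ = Re⟨x, Ax⟩ + Re⟨y, Ay⟩ + 2 Re⟨x, Ay⟩`. [folklore] -/
theorem re_quadForm_add {A : Matrix n n ℂ} (hA : A.IsHermitian) (x y : n → ℂ) :
    (star (x + y) ⬝ᵥ (A *ᵥ (x + y))).re =
      (star x ⬝ᵥ (A *ᵥ x)).re + (star y ⬝ᵥ (A *ᵥ y)).re + 2 * (star x ⬝ᵥ (A *ᵥ y)).re := by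
  have hyx : star y ⬝ᵥ (A *ᵥ x) = star (star x ⬝ᵥ (A *ᵥ y)) := by
    rw [star_dotProduct, star_mulVec, hA.eq, ← dotProduct_mulVec]
  rw [star_add, mulVec_add, add_dotProduct, dotProduct_add, dotProduct_add, hyx]
  simp only [Complex.add_re, Complex.star_def, Complex.conj_re]
  ring

omit [DecidableEq n] in
/-- **PSD polarisation.** For `A ⪰ 0`: `Re⟨x + y, A(x + y)⟩ ≥ ½ Re⟨x, Ax⟩ - Re⟨y, Ay⟩`
(from `0 ≤ ⟨x + 2y, A(x + 2y)⟩`). [folklore] -/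
theorem re_quadForm_add_ge_of_posSemidef {A : Matrix n n ℂ} (hA : A.PosSemidef) (x y : n → ℂ) :
    (star x ⬝ᵥ (A *ᵥ x)).re / 2 - (star y ⬝ᵥ (A *ᵥ y)).re ≤
      (star (x + y) ⬝ᵥ (A *ᵥ (x + y))).re := by
  have h1 := re_quadForm_add hA.isHermitian x y
  have h2 := re_quadForm_add hA.isHermitian x (((2 : ℝ) : ℂ) • y)
  have hpos : 0 ≤ (star (x + ((2 : ℝ) : ℂ) • y) ⬝ᵥ (A *ᵥ (x + ((2 : ℝ) : ℂ) • y))).re :=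
    (Complex.nonneg_iff.1 (hA.dotProduct_mulVec_nonneg _)).1
  have hyy : (star (((2 : ℝ) : ℂ) • y) ⬝ᵥ (A *ᵥ (((2 : ℝ) : ℂ) • y))).re =
      4 * (star y ⬝ᵥ (A *ᵥ y)).re := by
    rw [star_smul, mulVec_smul, smul_dotProduct, dotProduct_smul, smul_smul, smul_eq_mul,
      Complex.star_def, Complex.conj_ofReal, ← Complex.ofReal_mul, Complex.re_ofReal_mul]
    norm_num
  have hxy : (star x ⬝ᵥ (A *ᵥ (((2 : ℝ) : ℂ) • y))).re = 2 * (star x ⬝ᵥ (A *ᵥ y)).re := by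
    rw [mulVec_smul, dotProduct_smul, smul_eq_mul, Complex.re_ofReal_mul]
  rw [hyy, hxy] at h2
  linarith

omit [DecidableEq n] in
/-- Homogenisation: a bound `m ≤ Re⟨ψ, Aψ⟩` on the unit vectors of a subspace `E` is the bound
`m·Re⟨v, v⟩ ≤ Re⟨v, Av⟩` on all of `E`. [folklore] -/
theorem mul_re_le_re_quadForm_of_unit_bound (E : Submodule ℂ (n → ℂ)) {A : Matrix n n ℂ} {m : ℝ}
    (h : ∀ ψ ∈ E, star ψ ⬝ᵥ ψ = 1 → m ≤ (star ψ ⬝ᵥ (A *ᵥ ψ)).re) (v : n → ℂ) (hv : v ∈ E) :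
    m * (star v ⬝ᵥ v).re ≤ (star v ⬝ᵥ (A *ᵥ v)).re := by
  by_cases hv0 : v = 0
  · subst hv0; simp
  obtain ⟨c, -, hc1, hcc⟩ := exists_real_smul_unit_of_ne_zero hv0
  have h1 := h _ (E.smul_mem _ hv) hc1
  rw [star_smul, mulVec_smul, smul_dotProduct, dotProduct_smul, smul_smul, smul_eq_mul,
    Complex.star_def, Complex.conj_ofReal, ← Complex.ofReal_mul, Complex.re_ofReal_mul, ← sq] at h1
  have hr0 : 0 ≤ (star v ⬝ᵥ v).re := (Complex.nonneg_iff.mp (dotProduct_star_self_nonneg v)).1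
  calc m * (star v ⬝ᵥ v).re ≤ c ^ 2 * (star v ⬝ᵥ (A *ᵥ v)).re * (star v ⬝ᵥ v).re :=
        mul_le_mul_of_nonneg_right h1 hr0
    _ = (star v ⬝ᵥ (A *ᵥ v)).re * (c ^ 2 * (star v ⬝ᵥ v).re) := by ring
    _ = (star v ⬝ᵥ (A *ᵥ v)).re := by rw [hcc, mul_one]

/-- **Ground states of the penalised Hamiltonian are nearly `A`-minimising.** `H` Hermitian,
`A ⪰ 0` with `Re⟨v, Av⟩ ≤ M‖v‖²`, `K` invariant under `H`, `e = minEnergyOn H K`, `E₀` the sector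
ground eigenspace of `H`, every-ground-state floor `m‖ψ‖² ≤ Re⟨ψ, Aψ⟩` on `E₀` (`m ≥ 0`), `γ > 0`
a gap of `H` above `e`, and `g > 0` small: `2gM(m + 2M) ≤ γm`. Then every unit `φ ∈ K` whose
penalised energy is variationally small, `Re⟨φ, Hφ⟩ + g·Re⟨φ, Aφ⟩ ≤ e + gM` (every ground state of
`H + gA` in `K` qualifies), has `Re⟨φ, Aφ⟩ ≥ m/4`. Proof: `φ = φ₀ + φ₁`, `φ₀ = P_{E₀}φ`;
`Re⟨φ, Hφ⟩ ≥ e + γ‖φ₁‖²` (second-eigenvalue bound), so `γ‖φ₁‖² ≤ gM`; PSD polarisation gives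
`Re⟨φ, Aφ⟩ ≥ ½m‖φ₀‖² - M‖φ₁‖²`. Kato (1966) §II.5 (variational form). [folklore] -/
theorem re_quadForm_ge_of_penalisedGroundState {H A : Matrix n n ℂ} (hH : H.IsHermitian)
    (hA : A.PosSemidef) (K : Submodule ℂ (n → ℂ)) (hKH : ∀ v ∈ K, H *ᵥ v ∈ K) {M m g γ : ℝ}
    (hM : ∀ v : n → ℂ, (star v ⬝ᵥ (A *ᵥ v)).re ≤ M * (star v ⬝ᵥ v).re) (hm0 : 0 ≤ m)
    (hm : ∀ ψ ∈ K ⊓ Module.End.eigenspace (Matrix.toLin' H) ((H.minEnergyOn K : ℝ) : ℂ),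
      m * (star ψ ⬝ᵥ ψ).re ≤ (star ψ ⬝ᵥ (A *ᵥ ψ)).re)
    (hγ : 0 < γ)
    (hgap : ∀ i, H.minEnergyOn K < hH.eigenvalues i → H.minEnergyOn K + γ ≤ hH.eigenvalues i)
    (hg : 0 < g) (hgs : 2 * g * M * (m + 2 * M) ≤ γ * m)
    {φ : n → ℂ} (hφK : φ ∈ K) (hφ1 : star φ ⬝ᵥ φ = 1)
    (hφE : (star φ ⬝ᵥ (H *ᵥ φ)).re + g * (star φ ⬝ᵥ (A *ᵥ φ)).re ≤ H.minEnergyOn K + g * M) :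
    m / 4 ≤ (star φ ⬝ᵥ (A *ᵥ φ)).re := by
  set e : ℝ := H.minEnergyOn K with he
  set E₀ : Submodule ℂ (n → ℂ) := K ⊓ Module.End.eigenspace (Matrix.toLin' H) ((e : ℝ) : ℂ)
    with hE₀
  set P₀ := projMatrix (E₀.map ((WithLp.linearEquiv 2 ℂ (n → ℂ)).symm :
    (n → ℂ) →ₗ[ℂ] EuclideanSpace ℂ n)) with hP₀
  set φ₀ : n → ℂ := P₀ *ᵥ φ with hφ₀
  set φ₁ : n → ℂ := φ - φ₀ with hφ₁
  have hdecomp : φ = φ₀ + φ₁ := by rw [hφ₁]; abel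
  -- membership
  have hφ₀E : φ₀ ∈ E₀ := projMatrix_map_mulVec_mem E₀ φ
  have hφ₀K : φ₀ ∈ K := (Submodule.mem_inf.1 hφ₀E).1
  have hHφ₀ : H *ᵥ φ₀ = ((e : ℝ) : ℂ) • φ₀ := by
    have := (Submodule.mem_inf.1 hφ₀E).2
    rwa [Module.End.mem_eigenspace_iff, Matrix.toLin'_apply] at this
  have hφ₁K : φ₁ ∈ K := K.sub_mem hφK hφ₀K
  have horth : ∀ w ∈ E₀, star w ⬝ᵥ φ₁ = 0 := fun w hw =>
    star_dotProduct_sub_projMatrix_map_mulVec E₀ φ hw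
  clear_value φ₁ φ₀
  -- norms: `1 = n0 + n1`
  set n0 : ℝ := (star φ₀ ⬝ᵥ φ₀).re with hn0
  set n1 : ℝ := (star φ₁ ⬝ᵥ φ₁).re with hn1
  have h01 : star φ₀ ⬝ᵥ φ₁ = 0 := horth φ₀ hφ₀E
  have h10 : star φ₁ ⬝ᵥ φ₀ = 0 := by
    rw [star_dotProduct, h01, star_zero]
  have hnorm : n0 + n1 = 1 := by
    have h : star φ ⬝ᵥ φ = star φ₀ ⬝ᵥ φ₀ + star φ₁ ⬝ᵥ φ₁ := by
      conv_lhs => rw [hdecomp]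
      rw [star_add, add_dotProduct, dotProduct_add, dotProduct_add, h01, h10]
      ring
    have := congrArg Complex.re h
    rw [hφ1, Complex.one_re, Complex.add_re] at this
    linarith
  have hn0pos : 0 ≤ n0 := (Complex.nonneg_iff.mp (dotProduct_star_self_nonneg φ₀)).1
  have hn1pos : 0 ≤ n1 := (Complex.nonneg_iff.mp (dotProduct_star_self_nonneg φ₁)).1
  -- energy: `Re⟨φ, Hφ⟩ = e n0 + Re⟨φ₁, Hφ₁⟩ ≥ e + γ n1`
  have hH01 : star φ₀ ⬝ᵥ (H *ᵥ φ₁) = 0 := by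
    have hst : star (H *ᵥ φ₀) = star φ₀ ᵥ* H := by rw [star_mulVec, hH.eq]
    rw [dotProduct_mulVec, ← hst, hHφ₀, star_smul, smul_dotProduct, h01, smul_zero]
  have hH10 : star φ₁ ⬝ᵥ (H *ᵥ φ₀) = 0 := by
    rw [hHφ₀, dotProduct_smul, h10, smul_zero]
  have hH00 : (star φ₀ ⬝ᵥ (H *ᵥ φ₀)).re = e * n0 := by
    rw [hHφ₀, dotProduct_smul, smul_eq_mul, Complex.re_ofReal_mul]
  have hHsplit : (star φ ⬝ᵥ (H *ᵥ φ)).re = e * n0 + (star φ₁ ⬝ᵥ (H *ᵥ φ₁)).re := by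
    have h : star φ ⬝ᵥ (H *ᵥ φ) = star φ₀ ⬝ᵥ (H *ᵥ φ₀) + star φ₁ ⬝ᵥ (H *ᵥ φ₁) := by
      conv_lhs => rw [hdecomp]
      rw [star_add, mulVec_add, add_dotProduct, dotProduct_add, dotProduct_add, hH01, hH10]
      ring
    rw [h, Complex.add_re, hH00]
  have hsecond : (e + γ) * n1 ≤ (star φ₁ ⬝ᵥ (H *ᵥ φ₁)).re :=
    re_quadForm_ge_of_orthogonal_groundSpace hH K hKH hgap hφ₁K horth
  -- the pair form: `a ≥ 0`, `γ n1 ≤ g M`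
  set a : ℝ := (star φ ⬝ᵥ (A *ᵥ φ)).re with ha
  have ha0 : 0 ≤ a := (Complex.nonneg_iff.1 (hA.dotProduct_mulVec_nonneg φ)).1
  have hga : 0 ≤ g * a := mul_nonneg hg.le ha0
  have hen : e * n0 + e * n1 = e := by rw [← mul_add, hnorm, mul_one]
  have hsecond' : e * n1 + γ * n1 ≤ (star φ₁ ⬝ᵥ (H *ᵥ φ₁)).re := by
    have : (e + γ) * n1 = e * n1 + γ * n1 := by ring
    linarith [hsecond]
  have hn1 : γ * n1 ≤ g * M := by linarith
  -- polarisation: `a ≥ ½ Re⟨φ₀, Aφ₀⟩ - Re⟨φ₁, Aφ₁⟩ ≥ ½ m n0 - M n1`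
  have hpol := re_quadForm_add_ge_of_posSemidef hA φ₀ φ₁
  rw [← hdecomp] at hpol
  have hq0 : m * n0 ≤ (star φ₀ ⬝ᵥ (A *ᵥ φ₀)).re := hm φ₀ hφ₀E
  have hq1 : (star φ₁ ⬝ᵥ (A *ᵥ φ₁)).re ≤ M * n1 := hM φ₁
  have hM0 : 0 ≤ M := by
    have := (Complex.nonneg_iff.1 (hA.dotProduct_mulVec_nonneg φ)).1
    have h2 := hM φ
    rw [hφ1, Complex.one_re, mul_one] at h2
    linarith
  have hmain : m / 2 * n0 - M * n1 ≤ a := by linarith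
  -- arithmetic: `γ a ≥ γ m/2 - (m/2 + M) γ n1 ≥ γ m/2 - (m/2 + M) g M ≥ γ m/4`
  rw [show n0 = 1 - n1 by linarith] at hmain
  have hkey : γ * (m / 4) ≤ γ * a := by nlinarith
  exact le_of_mul_le_mul_left hkey hγ


end Abstract

end Summit.HubbardSuperconductivity.HubbardSuperconductivity.Theorems.BirGroundStateAverageLRO.Softmin
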